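import Mathlib
import Summits.RiemannHypothesis.RiemannHypothesis.Theorems.IntegerScrewWalkPoincareMertens
import HarnessLib

/-!
# Route `IntegerScrew` — the window bracket of a THIN bottom by two Poincaré inequalities
# (CONTINUUM-LIMIT §25.10 (d), the extreme thresholds, in the kernel)

In the mixture lemma (`IntegerScrewTiltMixture`, `IntegerScrewExitAtomTilt`) the tilt is priced by the brackets
`Br(θ) = H(θ)·G(Q)/H(Q) − G(θ) = H(θ)·(ḡ_Q − m_θ)` (`H(θ) = Σ_{b≤θ} 1/b`, `G(θ) = Σ_{b≤θ} g(b)/b`, `ḡ_Q`, `m_θ`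
the harmonic means of `g` over `[1, Q]` and `[1, θ]`).  THEOREM A's chain bounds `Br(θ)²` by `O(1)·D_Q(g)` only
for `log²θ ≳ log Q`; for the thin bottoms `θ < e^{√(c log Q)}` this file gives the elementary substitute
obtained from PROP. 24.7 at the two levels `Q` and `θ` (both paths through the point `1`):

* `bracket_eq` — `Br(θ) = (H(θ)/H(Q))·Σ_{b≤Q}(1/b)(g(b) − g(1)) − Σ_{b≤θ}(1/b)(g(b) − g(1))`;
* **`bracket_sq_le`** — `Br(θ)² ≤ 2·(H(θ)²/H(Q))·V_Q + 2·H(θ)·V_θ`, `V_N = Σ_{b≤N}(1/b)(g(b) − g(1))²`;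
* **`bracket_sq_le_dirichlet`** — with a Mertens constant `C`:
  `Br(θ)² ≤ 2C·(H(θ)²·⌊log₂Q⌋/H(Q) + H(θ)·⌊log₂θ⌋)·D_Q(g)` (`D_Q` the Dirichlet form of `Ω_Q`), i.e.
  `|Br(θ)| = O(H(θ))·√D_Q` uniformly in `θ` — summed against `|ΔT(θ)| ≈ L/(θλ²)` over `θ < e^{√(c log Q)}` this is
  `O(u(u−1))·√D_Q`, bounded (25.10 (d)); `bracket_sq_le_dirichlet_exp_five` (`C = e⁵`).

RH-free, elementary.  Nothing in this file bears on the truth of RH.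
References: CONTINUUM-LIMIT §25.10 (rh-explicit A6-PIVOT); M. Suzuki, J. Lond. Math. Soc. (2) 108 (2023)
1448–1487 [Suzuki2023].
-/

noncomputable section

set_option linter.dupNamespace false -- D-0017: `Summit.<S>.<S>.…` is the designed namespace

namespace Summit.RiemannHypothesis.RiemannHypothesis.Theorems.IntegerScrew

open Finset Real
open ArithmeticFunction (vonMangoldt)

/-! ### The bracket recentred at `g(1)` -/

/-- `Br(θ) = (H(θ)/H(Q))·Σ_{b≤Q}(1/b)(g(b) − g(1)) − Σ_{b≤θ}(1/b)(g(b) − g(1))` (`H(Q) ≠ 0`). -/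
theorem bracket_eq (g : ℕ → ℝ) (θ : ℕ) {Q : ℕ} (hH : (∑ b ∈ Icc 1 Q, (1 : ℝ) / b) ≠ 0) :
    (∑ b ∈ Icc 1 θ, (1 : ℝ) / b) * (∑ b ∈ Icc 1 Q, g b / b) / (∑ b ∈ Icc 1 Q, (1 : ℝ) / b) -
        ∑ b ∈ Icc 1 θ, g b / b =
      (∑ b ∈ Icc 1 θ, (1 : ℝ) / b) / (∑ b ∈ Icc 1 Q, (1 : ℝ) / b) * ∑ b ∈ Icc 1 Q, (1 / (b : ℝ)) * (g b - g 1) -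
        ∑ b ∈ Icc 1 θ, (1 / (b : ℝ)) * (g b - g 1) := by
  have e1 : ∑ b ∈ Icc 1 Q, (1 / (b : ℝ)) * (g b - g 1) = ∑ b ∈ Icc 1 Q, g b / b - g 1 * ∑ b ∈ Icc 1 Q, (1 : ℝ) / b := by
    rw [Finset.mul_sum, ← Finset.sum_sub_distrib]; exact Finset.sum_congr rfl fun b _ => by ring
  have e2 : ∑ b ∈ Icc 1 θ, (1 / (b : ℝ)) * (g b - g 1) = ∑ b ∈ Icc 1 θ, g b / b - g 1 * ∑ b ∈ Icc 1 θ, (1 : ℝ) / b := by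
    rw [Finset.mul_sum, ← Finset.sum_sub_distrib]; exact Finset.sum_congr rfl fun b _ => by ring
  rw [e1, e2]
  field_simp
  ring

/-! ### Two Cauchy–Schwarz steps -/

/-- `(Σ_{b≤N}(1/b)(g(b) − g(1)))² ≤ H(N)·V_N`. -/
theorem sum_inv_mul_sub_sq_le (g : ℕ → ℝ) (N : ℕ) :
    (∑ b ∈ Icc 1 N, (1 / (b : ℝ)) * (g b - g 1)) ^ 2 ≤
      (∑ b ∈ Icc 1 N, (1 : ℝ) / b) * ∑ b ∈ Icc 1 N, (1 / (b : ℝ)) * (g b - g 1) ^ 2 := by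
  refine Finset.sum_sq_le_sum_mul_sum_of_sq_le_mul (Icc 1 N) (fun b hb => by positivity) (fun b hb => by positivity)
    (fun b hb => le_of_eq ?_)
  ring

/-- **The bracket by two Poincaré sums**: `Br(θ)² ≤ 2·(H(θ)²/H(Q))·V_Q + 2·H(θ)·V_θ` (`1 ≤ Q`). -/
theorem bracket_sq_le (g : ℕ → ℝ) (θ : ℕ) {Q : ℕ} (hQ : 1 ≤ Q) :
    ((∑ b ∈ Icc 1 θ, (1 : ℝ) / b) * (∑ b ∈ Icc 1 Q, g b / b) / (∑ b ∈ Icc 1 Q, (1 : ℝ) / b) -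
        ∑ b ∈ Icc 1 θ, g b / b) ^ 2 ≤
      2 * ((∑ b ∈ Icc 1 θ, (1 : ℝ) / b) ^ 2 / ∑ b ∈ Icc 1 Q, (1 : ℝ) / b) *
          ∑ b ∈ Icc 1 Q, (1 / (b : ℝ)) * (g b - g 1) ^ 2 +
        2 * (∑ b ∈ Icc 1 θ, (1 : ℝ) / b) * ∑ b ∈ Icc 1 θ, (1 / (b : ℝ)) * (g b - g 1) ^ 2 := by
  have hH : 0 < ∑ b ∈ Icc 1 Q, (1 : ℝ) / b :=
    Finset.sum_pos (fun b hb => by have := (Finset.mem_Icc.1 hb).1; positivity) ⟨1, by simp [hQ]⟩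
  rw [bracket_eq g θ hH.ne']
  set Hθ := ∑ b ∈ Icc 1 θ, (1 : ℝ) / b with hHθ
  set HQ := ∑ b ∈ Icc 1 Q, (1 : ℝ) / b with hHQ
  set SQ := ∑ b ∈ Icc 1 Q, (1 / (b : ℝ)) * (g b - g 1) with hSQ
  set Sθ := ∑ b ∈ Icc 1 θ, (1 / (b : ℝ)) * (g b - g 1) with hSθ
  set VQ := ∑ b ∈ Icc 1 Q, (1 / (b : ℝ)) * (g b - g 1) ^ 2 with hVQ
  set Vθ := ∑ b ∈ Icc 1 θ, (1 / (b : ℝ)) * (g b - g 1) ^ 2 with hVθ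
  have h1 : SQ ^ 2 ≤ HQ * VQ := sum_inv_mul_sub_sq_le g Q
  have h2 : Sθ ^ 2 ≤ Hθ * Vθ := sum_inv_mul_sub_sq_le g θ
  have hHθ0 : 0 ≤ Hθ := Finset.sum_nonneg fun b _ => by positivity
  -- (a − b)² ≤ 2a² + 2b², a = (Hθ/HQ)·SQ
  have h3 : (Hθ / HQ * SQ) ^ 2 ≤ Hθ ^ 2 / HQ * VQ := by
    rw [mul_pow, div_pow]
    have : Hθ ^ 2 / HQ ^ 2 * SQ ^ 2 ≤ Hθ ^ 2 / HQ ^ 2 * (HQ * VQ) := mul_le_mul_of_nonneg_left h1 (by positivity)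
    calc Hθ ^ 2 / HQ ^ 2 * SQ ^ 2 ≤ Hθ ^ 2 / HQ ^ 2 * (HQ * VQ) := this
      _ = Hθ ^ 2 / HQ * VQ := by field_simp
  nlinarith [sq_nonneg (Hθ / HQ * SQ + Sθ), h3, mul_le_mul_of_nonneg_left h2 (show (0 : ℝ) ≤ 2 by norm_num)]

/-! ### With the Dirichlet form -/

/-- **The bracket against the Dirichlet form of `Ω_Q`** (Mertens constant `C` as a hypothesis): for `1 ≤ θ ≤ Q`,
`Br(θ)² ≤ 2C·(H(θ)²·⌊log₂Q⌋/H(Q) + H(θ)·⌊log₂θ⌋)·D_Q(g)`. -/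
theorem bracket_sq_le_dirichlet (g : ℕ → ℝ) {θ Q : ℕ} (hθ : 1 ≤ θ) (hθQ : θ ≤ Q) {C : ℝ}
    (hC : ∀ r : ℕ, r.Prime → r ≤ Q → ∏ q ∈ (r + 1).primesBelow, (1 - 1 / (q : ℝ))⁻¹ ≤ C * Real.log r) :
    ((∑ b ∈ Icc 1 θ, (1 : ℝ) / b) * (∑ b ∈ Icc 1 Q, g b / b) / (∑ b ∈ Icc 1 Q, (1 : ℝ) / b) -
        ∑ b ∈ Icc 1 θ, g b / b) ^ 2 ≤
      2 * C * ((∑ b ∈ Icc 1 θ, (1 : ℝ) / b) ^ 2 * (Nat.log 2 Q : ℝ) / (∑ b ∈ Icc 1 Q, (1 : ℝ) / b) +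
          (∑ b ∈ Icc 1 θ, (1 : ℝ) / b) * (Nat.log 2 θ : ℝ)) *
        ∑ x ∈ Icc 1 Q, (1 / (x : ℝ)) * ∑ n ∈ x.divisors, vonMangoldt n * (g x - g (x / n)) ^ 2 := by
  have hQ : 1 ≤ Q := le_trans hθ hθQ
  -- the degenerate case Q = 1 (= θ): both sides vanish
  rcases lt_or_ge Q 2 with hQ2 | hQ2
  · have hθ1 : θ = 1 := by omega
    have hQ1 : Q = 1 := by omega
    subst hθ1; subst hQ1
    simp
  have hCnn : 0 ≤ C := by
    have h1 : (1 : ℝ) ≤ ∏ q ∈ Nat.primesBelow (2 + 1), (1 - 1 / (q : ℝ))⁻¹ := one_le_prod_primesBelow_inv _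
    nlinarith [hC 2 Nat.prime_two hQ2, Real.log_pos (show (1 : ℝ) < 2 by norm_num)]
  have hH : 0 < ∑ b ∈ Icc 1 Q, (1 : ℝ) / b :=
    Finset.sum_pos (fun b hb => by have := (Finset.mem_Icc.1 hb).1; positivity) ⟨1, by simp [hQ]⟩
  have hHθ0 : 0 ≤ ∑ b ∈ Icc 1 θ, (1 : ℝ) / b := Finset.sum_nonneg fun b _ => by positivity
  set DQ := ∑ x ∈ Icc 1 Q, (1 / (x : ℝ)) * ∑ n ∈ x.divisors, vonMangoldt n * (g x - g (x / n)) ^ 2 with hDQ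
  set Dθ := ∑ x ∈ Icc 1 θ, (1 / (x : ℝ)) * ∑ n ∈ x.divisors, vonMangoldt n * (g x - g (x / n)) ^ 2 with hDθ
  have hterm : ∀ x : ℕ, 0 ≤ (1 / (x : ℝ)) * ∑ n ∈ x.divisors, vonMangoldt n * (g x - g (x / n)) ^ 2 := fun x =>
    mul_nonneg (by positivity) (Finset.sum_nonneg fun n _ => mul_nonneg ArithmeticFunction.vonMangoldt_nonneg (sq_nonneg _))
  have hDθQ : Dθ ≤ DQ := Finset.sum_le_sum_of_subset_of_nonneg (Finset.Icc_subset_Icc_right hθQ) fun x _ _ => hterm x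
  have hDQ0 : 0 ≤ DQ := Finset.sum_nonneg fun x _ => hterm x
  have hVQ := walk_poincare_mertens_dirichlet Q g hC
  have hVθ := walk_poincare_mertens_dirichlet θ g (fun r hr hrθ => hC r hr (hrθ.trans hθQ))
  have hb := bracket_sq_le g θ hQ
  rw [← hDQ] at hVQ
  rw [← hDθ] at hVθ
  have hA : 2 * ((∑ b ∈ Icc 1 θ, (1 : ℝ) / b) ^ 2 / ∑ b ∈ Icc 1 Q, (1 : ℝ) / b) *
      ∑ b ∈ Icc 1 Q, (1 / (b : ℝ)) * (g b - g 1) ^ 2 ≤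
      2 * ((∑ b ∈ Icc 1 θ, (1 : ℝ) / b) ^ 2 / ∑ b ∈ Icc 1 Q, (1 : ℝ) / b) * ((Nat.log 2 Q : ℝ) * C * DQ) :=
    mul_le_mul_of_nonneg_left hVQ (by positivity)
  have hB : 2 * (∑ b ∈ Icc 1 θ, (1 : ℝ) / b) * ∑ b ∈ Icc 1 θ, (1 / (b : ℝ)) * (g b - g 1) ^ 2 ≤
      2 * (∑ b ∈ Icc 1 θ, (1 : ℝ) / b) * ((Nat.log 2 θ : ℝ) * C * DQ) :=
    mul_le_mul_of_nonneg_left (hVθ.trans (mul_le_mul_of_nonneg_left hDθQ (by positivity))) (by positivity)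
  calc _ ≤ _ := hb
    _ ≤ 2 * ((∑ b ∈ Icc 1 θ, (1 : ℝ) / b) ^ 2 / ∑ b ∈ Icc 1 Q, (1 : ℝ) / b) * ((Nat.log 2 Q : ℝ) * C * DQ) +
        2 * (∑ b ∈ Icc 1 θ, (1 : ℝ) / b) * ((Nat.log 2 θ : ℝ) * C * DQ) := add_le_add hA hB
    _ = _ := by
        field_simp

/-- **The bracket against the Dirichlet form, unconditional Mertens constant `e⁵`.** -/
theorem bracket_sq_le_dirichlet_exp_five (g : ℕ → ℝ) {θ Q : ℕ} (hθ : 1 ≤ θ) (hθQ : θ ≤ Q) :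
    ((∑ b ∈ Icc 1 θ, (1 : ℝ) / b) * (∑ b ∈ Icc 1 Q, g b / b) / (∑ b ∈ Icc 1 Q, (1 : ℝ) / b) -
        ∑ b ∈ Icc 1 θ, g b / b) ^ 2 ≤
      2 * Real.exp 5 * ((∑ b ∈ Icc 1 θ, (1 : ℝ) / b) ^ 2 * (Nat.log 2 Q : ℝ) / (∑ b ∈ Icc 1 Q, (1 : ℝ) / b) +
          (∑ b ∈ Icc 1 θ, (1 : ℝ) / b) * (Nat.log 2 θ : ℝ)) *
        ∑ x ∈ Icc 1 Q, (1 / (x : ℝ)) * ∑ n ∈ x.divisors, vonMangoldt n * (g x - g (x / n)) ^ 2 :=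
  bracket_sq_le_dirichlet g hθ hθQ fun _ hr _ => prod_primesBelow_inv_le_exp_five_mul_log hr

end Summit.RiemannHypothesis.RiemannHypothesis.Theorems.IntegerScrew

end
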